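import Summits.AtomisticToContinuum.Crystallization.Theorems.OverbindingBudgetEnergyStraddleCount
import Summits.AtomisticToContinuum.Crystallization.Theorems.OverbindingBudgetEnergyLayerTailSum

/-!
# OverbindingBudget · decomp-a2c lens-4 g35 — part XXIII-Y₁: span bookkeeping + two-channel contraction (for the GAP CONTRACTION theorem)

Helper file under `--supports stmt-AtomisticToContinuum-31280` (RDEF = `Theses.OverbindingBudget.RobustDefectLimitWindows`); closes nothing.

Three self-contained ingredients of part Y₂ `…EnergyGapContraction.heights_band_of_force_rows` (the analytic core of GEO-OSC):
* §1 EXACT bookkeeping of the straddling pairs of a gap `m` of span `≤ S`: part X's parametrisation `pairOf m (s, i) = (m − s + i, m + i)`,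
  `i < s ≤ S`, is ONTO them (`mem_nearFin_iff`), so `Σ_{span p ≤ S} φ(span p) = Σ_{s ≤ S} s • φ s` (`sum_nearFin`); span offsets have height
  `⟪w l − w k, n⟫ = Σ_{k<i≤l} ⟪incr w i, n⟫` (`inner_span_eq_sum`).
* §2 the TWO-CHANNEL sup-norm contraction `two_channel_contraction` (an M-matrix inversion in dimension two): profiles with
  `G_n·x m ≤ a + C·sup x + C′·sup u`, `G_l·u m ≤ b + C·sup x + C′·sup u` have `sup x ≤ ((G_l − C′)a + C′b)/((G_n − C)(G_l − C′) − C′C)`.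
* §3 the TAIL majorant `tailMaj h_lo S s = 19·((s·h_lo)⁵)⁻¹·[s > S]` with `Σ_s s·tailMaj s ≤ 19/(h_lo⁵·3S³)` (part L's `Σ (i+S+1)⁻⁴ ≤ (3S³)⁻¹`).
-/

noncomputable section

namespace Summit.AtomisticToContinuum.Crystallization.Theorems.OverbindingBudgetEnergySpanBookkeeping

open Finset
open scoped RealInnerProductSpace
open Summit.AtomisticToContinuum.Crystallization.Theorems.ChartedPlanarOrderChunkFloor (E3)
open Summit.AtomisticToContinuum.Crystallization.Theorems.ChartedPlanarOrderProfileSlavingLJ (incr offsetOf offsetOf_incr)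
open Summit.AtomisticToContinuum.Crystallization.Theorems.ChartedPlanarOrderProfileSlavingLJBalance (straddleSet)
open Summit.AtomisticToContinuum.Crystallization.Theorems.OverbindingBudgetEnergyLayerTailSum (tsum_inv_pow_four_le)
open Summit.AtomisticToContinuum.Crystallization.Theorems.OverbindingBudgetEnergyStraddleCount (span pairOf span_pairOf pairOf_injOn)

/-! ## §1 Exact bookkeeping: the straddling pairs of span `≤ S` -/

/-- index set `{(s, i) : i < s ≤ S}` of part X's parametrisation `pairOf m (s, i) = (m − s + i, m + i)`. -/
def nearIdx (S : ℕ) : Finset ((_ : ℕ) × ℕ) := (range (S + 1)).sigma fun s => range s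

/-- the parametrised pairs straddle gap `m`. -/
theorem pairOf_mem_straddleSet {m : ℤ} {S : ℕ} {x : (_ : ℕ) × ℕ} (hx : x ∈ nearIdx S) : pairOf m x ∈ straddleSet m := by
  simp only [nearIdx, mem_sigma, mem_range] at hx
  simp only [pairOf, straddleSet, Set.mem_setOf_eq]
  constructor <;> omega

/-- the straddling pairs of gap `m` of span `≤ S`, as a finset of the straddle subtype. -/
def nearFin (m : ℤ) (S : ℕ) : Finset (straddleSet m) :=
  (nearIdx S).attach.image fun x => ⟨pairOf m x.1, pairOf_mem_straddleSet x.2⟩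

/-- the span of a straddling pair, as an integer, is `l − k ≥ 1`. -/
theorem span_cast (p : ℤ × ℤ) (h : p.1 < p.2) : ((span p : ℕ) : ℤ) = p.2 - p.1 := by
  simp only [span]; exact Int.toNat_of_nonneg (by omega)

/-- straddling pairs have span `≥ 1`. -/
theorem one_le_span {m : ℤ} (p : straddleSet m) : 1 ≤ span (p : ℤ × ℤ) := by
  have hp : (p : ℤ × ℤ).1 < m ∧ m ≤ (p : ℤ × ℤ).2 := p.2
  have := span_cast (p : ℤ × ℤ) (by omega)
  omega

/-- ★ membership: a straddling pair is in `nearFin m S` iff its span is `≤ S`. -/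
theorem mem_nearFin_iff {m : ℤ} {S : ℕ} (p : straddleSet m) : p ∈ nearFin m S ↔ span (p : ℤ × ℤ) ≤ S := by
  constructor
  · intro hp
    simp only [nearFin, mem_image, mem_attach, true_and, Subtype.exists] at hp
    obtain ⟨x, hx, hxp⟩ := hp
    have e : (p : ℤ × ℤ) = pairOf m x := by rw [← hxp]
    rw [e, span_pairOf]
    simp only [nearIdx, mem_sigma, mem_range] at hx
    omega
  · intro hS
    have hk : (p : ℤ × ℤ).1 < m ∧ m ≤ (p : ℤ × ℤ).2 := p.2
    have h2 : ((span (p : ℤ × ℤ) : ℕ) : ℤ) = (p : ℤ × ℤ).2 - (p : ℤ × ℤ).1 := span_cast _ (by omega)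
    have h1 : (((((p : ℤ × ℤ).2 - m).toNat : ℕ) : ℤ)) = (p : ℤ × ℤ).2 - m := Int.toNat_of_nonneg (by omega)
    set x : (_ : ℕ) × ℕ := ⟨span (p : ℤ × ℤ), ((p : ℤ × ℤ).2 - m).toNat⟩ with hxdef
    have hx : x ∈ nearIdx S := by
      simp only [nearIdx, mem_sigma, mem_range, hxdef]
      constructor <;> omega
    simp only [nearFin, mem_image, mem_attach, true_and, Subtype.exists]
    refine ⟨x, hx, ?_⟩
    apply Subtype.ext
    show pairOf m x = (p : ℤ × ℤ)
    simp only [pairOf, hxdef]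
    ext <;> simp only <;> omega

/-- ★ exact regrouping by span: `Σ_{p ∈ nearFin m S} φ(span p) = Σ_{s ≤ S} s • φ s` (the `s` pairs of span `s`). -/
theorem sum_nearFin {M : Type*} [AddCommMonoid M] (m : ℤ) (S : ℕ) (φ : ℕ → M) :
    ∑ p ∈ nearFin m S, φ (span (p : ℤ × ℤ)) = ∑ s ∈ range (S + 1), s • φ s := by
  classical
  have hinj : Set.InjOn (fun x : {x // x ∈ nearIdx S} => (⟨pairOf m x.1, pairOf_mem_straddleSet x.2⟩ : straddleSet m))
      ↑((nearIdx S).attach) := by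
    intro x _ y _ h
    have h' : pairOf m x.1 = pairOf m y.1 := congrArg Subtype.val h
    exact Subtype.ext (pairOf_injOn m S x.2 y.2 h')
  rw [nearFin, sum_image hinj]
  have e1 : ∑ x ∈ (nearIdx S).attach, φ (span (pairOf m x.1)) = ∑ x ∈ nearIdx S, φ (span (pairOf m x)) :=
    sum_attach (nearIdx S) fun x => φ (span (pairOf m x))
  rw [e1, nearIdx, sum_sigma]
  refine sum_congr rfl fun s _ => ?_
  simp only [span_pairOf, sum_const, card_range]

/-- sums over the `span` consecutive gaps `k < i ≤ l` of a profile bounded by `X` are `≤ span·X`. -/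
theorem sum_Ioc_le_span_mul {x : ℤ → ℝ} {X : ℝ} (hx : ∀ i, x i ≤ X) (k l : ℤ) :
    ∑ i ∈ Ioc k l, x i ≤ (span (k, l) : ℝ) * X := by
  have hcard : ((Ioc k l).card : ℝ) = (span (k, l) : ℝ) := by rw [Int.card_Ioc]; simp [span]
  calc ∑ i ∈ Ioc k l, x i ≤ ∑ _i ∈ Ioc k l, X := sum_le_sum fun i _ => hx i
    _ = (span (k, l) : ℝ) * X := by rw [sum_const, nsmul_eq_mul, hcard]

/-- the normal height of the span offset `w l − w k` is the sum of the gap heights `k < i ≤ l`. -/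
theorem inner_span_eq_sum (w : ℤ → E3) (n : E3) {k l : ℤ} (hkl : k ≤ l) :
    ⟪w l - w k, n⟫ = ∑ i ∈ Ioc k l, ⟪incr w i, n⟫ := by
  rw [← offsetOf_incr w hkl, offsetOf, sum_inner]

/-! ## §2 The two-channel sup-norm contraction (M-matrix inversion in dimension two) -/

/-- ★ if bounded nonnegative profiles `x, u` satisfy `G_n·x m ≤ a + C·sup x + C′·sup u` and `G_l·u m ≤ b + C·sup x + C′·sup u` at every `m`, with
`0 ≤ C < G_n`, `0 ≤ C′ < G_l` and `C′C < (G_n − C)(G_l − C′)`, then `sup x ≤ ((G_l − C′)a + C′b)/((G_n − C)(G_l − C′) − C′C)` and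
`sup u ≤ ((G_n − C)b + Ca)/((G_n − C)(G_l − C′) − C′C)`. -/
theorem two_channel_contraction {x u : ℤ → ℝ} {Gn Gl C C' a b τ : ℝ} (hx : ∀ m, 0 ≤ x m ∧ x m ≤ τ) (hu : ∀ m, 0 ≤ u m ∧ u m ≤ τ)
    (h : ∀ m, Gn * x m ≤ a + C * (⨆ m', x m') + C' * (⨆ m', u m') ∧ Gl * u m ≤ b + C * (⨆ m', x m') + C' * (⨆ m', u m'))
    (hC : 0 ≤ C) (hC' : 0 ≤ C') (hp : C < Gn) (hq : C' < Gl) (hdet : C' * C < (Gn - C) * (Gl - C')) :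
    (⨆ m', x m') ≤ ((Gl - C') * a + C' * b) / ((Gn - C) * (Gl - C') - C' * C) ∧
      (⨆ m', u m') ≤ ((Gn - C) * b + C * a) / ((Gn - C) * (Gl - C') - C' * C) := by
  set X := ⨆ m', x m' with hX
  set U := ⨆ m', u m' with hU
  have hbx : BddAbove (Set.range x) := ⟨τ, by rintro _ ⟨m, rfl⟩; exact (hx m).2⟩
  have hbu : BddAbove (Set.range u) := ⟨τ, by rintro _ ⟨m, rfl⟩; exact (hu m).2⟩
  have hGn : 0 < Gn := lt_of_le_of_lt hC hp
  have hGl : 0 < Gl := lt_of_le_of_lt hC' hq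
  have h1 : Gn * X ≤ a + C * X + C' * U := by
    have : X ≤ (a + C * X + C' * U) / Gn := ciSup_le fun m => by rw [le_div_iff₀ hGn, mul_comm]; exact (h m).1
    rwa [le_div_iff₀ hGn, mul_comm] at this
  have h2 : Gl * U ≤ b + C * X + C' * U := by
    have : U ≤ (b + C * X + C' * U) / Gl := ciSup_le fun m => by rw [le_div_iff₀ hGl, mul_comm]; exact (h m).2
    rwa [le_div_iff₀ hGl, mul_comm] at this
  have hD : 0 < (Gn - C) * (Gl - C') - C' * C := by linarith
  have hq' : 0 < Gl - C' := by linarith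
  have hp' : 0 < Gn - C := by linarith
  -- eliminate `U` resp. `X`
  have e1 : ((Gn - C) * (Gl - C') - C' * C) * X ≤ (Gl - C') * a + C' * b := by
    have i1 : (Gl - C') * ((Gn - C) * X - C' * U) ≤ (Gl - C') * a := mul_le_mul_of_nonneg_left (by linarith) hq'.le
    have i2 : C' * ((Gl - C') * U - C * X) ≤ C' * b := mul_le_mul_of_nonneg_left (by linarith) hC'
    nlinarith
  have e2 : ((Gn - C) * (Gl - C') - C' * C) * U ≤ (Gn - C) * b + C * a := by
    have i1 : (Gn - C) * ((Gl - C') * U - C * X) ≤ (Gn - C) * b := mul_le_mul_of_nonneg_left (by linarith) hp'.le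
    have i2 : C * ((Gn - C) * X - C' * U) ≤ C * a := mul_le_mul_of_nonneg_left (by linarith) hC
    nlinarith
  constructor
  · rw [le_div_iff₀ hD]; linarith
  · rw [le_div_iff₀ hD]; linarith

/-! ## §3 The tail majorant -/

/-- the tail majorant beyond span `S`: `19·((s·h_lo)⁵)⁻¹`. -/
def tailMaj (hlo : ℝ) (S s : ℕ) : ℝ := if S < s then 19 * (((s : ℝ) * hlo) ^ 5)⁻¹ else 0

/-- the tail majorant is nonnegative. -/
theorem tailMaj_nonneg {hlo : ℝ} (hlo0 : 0 < hlo) (S s : ℕ) : 0 ≤ tailMaj hlo S s := by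
  unfold tailMaj; split_ifs <;> positivity

/-- the tail sum: `Σ_s s·tailMaj s` is summable with sum `≤ 19/(h_lo⁵·3S³)` (`S ≥ 1`; part L's `Σ_{i ≥ 0} (i+S+1)⁻⁴ ≤ (3S³)⁻¹`). -/
theorem tsum_tailMaj_le {hlo : ℝ} (hlo0 : 0 < hlo) {S : ℕ} (hS : 1 ≤ S) :
    Summable (fun s : ℕ => (s : ℝ) * tailMaj hlo S s) ∧
      ∑' s : ℕ, (s : ℝ) * tailMaj hlo S s ≤ 19 / hlo ^ 5 * (3 * (S : ℝ) ^ 3)⁻¹ := by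
  have hS' : (1 : ℝ) ≤ S := by exact_mod_cast hS
  obtain ⟨hsum, hle⟩ := tsum_inv_pow_four_le hS'
  -- the shifted terms
  have hshift : ∀ i : ℕ, ((i + (S + 1) : ℕ) : ℝ) * tailMaj hlo S (i + (S + 1)) = 19 / hlo ^ 5 * ((((i : ℝ) + S + 1) ^ 4)⁻¹) := by
    intro i
    have hpos : (0 : ℝ) < (i : ℝ) + S + 1 := by positivity
    unfold tailMaj
    rw [if_pos (by omega)]
    push_cast
    field_simp
    ring
  have hsum' : Summable fun i : ℕ => ((i + (S + 1) : ℕ) : ℝ) * tailMaj hlo S (i + (S + 1)) := by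
    simp_rw [hshift]; exact hsum.mul_left _
  have hsumall : Summable (fun s : ℕ => (s : ℝ) * tailMaj hlo S s) := (summable_nat_add_iff (S + 1)).1 hsum'
  refine ⟨hsumall, ?_⟩
  rw [← Summable.sum_add_tsum_nat_add (S + 1) hsumall]
  have hzero : ∑ s ∈ range (S + 1), (s : ℝ) * tailMaj hlo S s = 0 := by
    refine sum_eq_zero fun s hs => ?_
    rw [mem_range] at hs
    unfold tailMaj; rw [if_neg (by omega), mul_zero]
  rw [hzero, zero_add]
  simp_rw [hshift]
  rw [tsum_mul_left]
  exact mul_le_mul_of_nonneg_left hle (by positivity)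

end Summit.AtomisticToContinuum.Crystallization.Theorems.OverbindingBudgetEnergySpanBookkeeping

end
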